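import Literature.NumberTheory.Rogawski1990.ArchCartanWallExtensionGDocks  -- ★ brings `orbFamGExt` (★ `ArchHCOrbitalFamilyGExt`) + ★ `ArchTransfFamilyWallGeometry` (`exists_nhds_hcSemireg`, `mem_regG_of_offWall`, `contDiff_archERhoG`) + ★ `ArchHCSpaceG`
import Mathlib.Analysis.Calculus.ContDiff.Bounds
import HarnessLib

/-!
# (I₁) AT THE FACES: local jet bounds of `orbFamGExt` at a semiregular wall point from a smooth MODEL of the twisted family off the wall
# («(B2) FACES WITH PARAMETERS», binder form — Harish-Chandra ∕ Varadarajan 1977 I §1.12; Bouaziz 1994 §3.1 (I₁)–(I₂); Shelstad 1979 §4)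

Topic `NumberTheory/Rogawski1990`; namespaces `Literature.Analysis.Calculus` (§1, generic) and `Literature.NumberTheory.Rogawski1990` (§2–§4).  THEOREMS ONLY (no `def`, no instance,
no notation, no axiom, no named fact, no `sorry`).  Cell `pub/hodgecm-mathlib`, crux H413 (`stmt-HodgeConjecture-24833`), F0∕P3c line LH3 (closer stub `stub_N9`, DIRECT ROAD), LETTER L1
`HcOrbitalFamiliesStatement`, clause (I₁) `∀ n K, IsCompact K → BddAbove (‖iteratedFDeriv ℝ n (F S′) ·‖ '' (K ∩ InRegG s S′))` of ★ `ArchHcSmoothOneSided` for the genuine family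
`F = orbFamGExt L α ν′ a′`: brick **(B2) «FACES WITH PARAMETERS»** of LH7-p04 (g4)'s (I₁-CENSUS) ∕ LH3-plan (g3) RULING #15 (deal 2026-09-02T10:13:23Z), seat LH3-p02 (g4).  Count-neutral.

THE MATHEMATICS.  ★ `bddAbove_norm_iteratedFDeriv_inter_inRegG_of_forall_wall` (LH7-p04, (B1)) reduces (I₁) to LOCAL bounds at the wall points: `∀ x ∉ InRegG, ∃ U ∈ 𝓝 x,
BddAbove (‖Dⁿ(F S′)‖ '' (U ∩ InRegG))` («`hwall`»).  At a FACE — a semiregular point `p` of ONE noncompact wall `(w, i, j)` (`HcSemireg`, `slotSign w i ≠ slotSign w j`) — `InRegG` is, near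
`p`, just the complement of that wall (§2, over ★ `exists_nhds_hcSemireg` ∕ ★ `mem_regG_of_offWall`), and Harish-Chandra descent to the `U(1,1)_w`-block ((B-desc), LH3-p04, parametric
edition) writes the TWISTED family there as a model: `e^{ρ}_{S′}(c) · orbFamGExt S′ c = H c = H₂ (π c, ν c)` with `H₂ (q, ψ) = F (Θ♯_q) ψ` the rank-one elliptic orbital functional of a
smooth compactly supported FAMILY of block test functions indexed by the transversal coordinates `q` (normal coordinate `ψ = ν c`).  The rank-one engine ★ (ELL-∞-UNIF)
`exists_forall_eventually_norm_iteratedDeriv_orbitalIntegral_comp_clm_le` (read at `E′ = ℓ^∞(Q, ℂ)` through (B2a)) bounds every mixed partial `∂_ψ^a ∂_q^β H₂` on a punctured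
product box, hence ((B2b) ★ `exists_forall_norm_iteratedFDeriv_le_of_foldr_fderiv_basis`) every jet of `H₂` there.  THIS FILE is the assembly in BINDER FORM (the model and its jet
bounds are hypotheses; nothing upstream is re-typed):
* §1 (generic) `norm_iteratedFDeriv_comp_clm_le_of_isOpen` ∕ `bddAbove_norm_iteratedFDeriv_comp_clm_image` — jets of a pull-back along a continuous linear chart
  (`‖Dⁿ(H ∘ g)‖ ≤ ‖g‖ⁿ ‖DⁿH‖`), and `exists_nhds_bddAbove_norm_iteratedFDeriv_mul` — Leibniz packaging of LOCAL jet bounds against a globally smooth factor;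
* §2 `exists_nhds_forall_mem_inRegG_iff_of_hcSemireg` — near a semiregular point `InRegG s S′ = {e^{ic_wi} ≠ e^{ic_wj}} = {c w i ≠ c w j}` (and off the wall the point is `G`-regular);
* §3 HEAD **`exists_nhds_bddAbove_norm_iteratedFDeriv_orbFamGExt_of_faceModel`**: twisted identity off the wall near `p` + the model `Cⁿ` with bounded jets of order `≤ n` near `p`
  off the wall ⇒ `∃ U′ ∈ 𝓝 p, BddAbove (‖Dⁿ(orbFamGExt ν′ a′ S′)‖ '' (U′ ∩ InRegG (slotSign α) S′))` = the `hwall` binder at `p` VERBATIM (the smooth unit `(e^{ρ})⁻¹` by Leibniz;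
  `∀ n` corollary `forall_…`);
* §4 **`exists_nhds_bddAbove_norm_iteratedFDeriv_orbFamGExt_of_productModel`** — the same with the model read in PRODUCT COORDINATES `H = H₂ ∘ A` for any continuous linear chart
  `A : V →L P` (e.g. `A c = (π c, ν c)`) and bounded jets of `H₂` on an open `O₂ ⊆ P` containing the off-wall image (e.g. the punctured box `Q ×ˢ {0 < |ψ| < δ}`).
ED. 2 (append-only, once ★ (B2a) and (B-par)'s reader clauses land): the MODEL-JETS producer for `H₂ (q, ψ) = F (Θ♯ q) ψ` discharging §4's `hH₂s`∕`hH₂b`, so that the face `hwall`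
follows from (B-desc)'s parametric identity alone.
HONEST LABEL: the compact-SCALAR corners (B3) are NOT touched here (print-grade organ «HC-CENTRAL», RULING #15); HC_CM is proved only modulo the 7 printed citations (2 remaining:
hLiu418 = `stmt-HodgeConjecture-24832`, h413 = `stmt-HodgeConjecture-24833`) until rung 0 closes; this file moves no row of the books.

## References
* [Varadarajan1977] V. S. Varadarajan, *Harmonic Analysis on Real Reductive Groups*, LNM 576 (1977), Part I §1.12 (`'F_f`: bounded derivatives on `T_{in-reg}`), Part I §3.
* [Bouaziz1994IntegralesOrbitales] A. Bouaziz, *Intégrales orbitales sur les groupes de Lie réductifs*, Ann. Sci. ÉNS 27 (1994), §3.1 (I₁)–(I₂) p. 579, §3.2 p. 580, §6.2 p. 591.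
* [Shelstad1979] D. Shelstad, *Characters and inner forms of a quasi-split group over ℝ*, Compositio Math. 39 (1979), §4 pp. 22–24.
* [HormanderALPDO1] L. Hörmander, *The Analysis of Linear Partial Differential Operators I*, 2nd ed. (1990), §1.1 (1.1.8)–(1.1.9) (chain rule, Leibniz for higher derivatives).
-/

set_option autoImplicit false

noncomputable section

open Set Filter Topology Function MeasureTheory NumberField NumberField.InfinitePlace
open scoped ContDiff MatrixGroups Matrix Classical

/-! ## §1 Generic calculus: jets of a pull-back along a continuous linear map; Leibniz packaging of local jet bounds -/

namespace Literature.Analysis.Calculus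

variable {V V' F : Type*} [NormedAddCommGroup V] [NormedSpace ℝ V] [NormedAddCommGroup V'] [NormedSpace ℝ V'] [NormedAddCommGroup F] [NormedSpace ℝ F]

/-- **Jets of a pull-back along a continuous linear map**: for `H` of class `Cⁿ` on an OPEN `O′` and `g : V →L V′`, at every `x` with `g x ∈ O′`,
`‖Dⁿ(H ∘ g)(x)‖ ≤ ‖g‖ⁿ · ‖DⁿH(g x)‖` (chain rule `iteratedFDerivWithin_comp_right` on the open preimage + `norm_compContinuousLinearMap_le`). [cite: HormanderALPDO1, §1.1 (1.1.8)] -/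
theorem norm_iteratedFDeriv_comp_clm_le_of_isOpen (g : V →L[ℝ] V') {O' : Set V'} (hO' : IsOpen O') {H : V' → F} {n : ℕ} (hH : ContDiffOn ℝ n H O')
    {x : V} (hx : g x ∈ O') :
    ‖iteratedFDeriv ℝ n (H ∘ g) x‖ ≤ ‖g‖ ^ n * ‖iteratedFDeriv ℝ n H (g x)‖ := by
  have hpre : IsOpen (g ⁻¹' O') := hO'.preimage g.continuous
  have h1 : iteratedFDeriv ℝ n (H ∘ g) x = iteratedFDerivWithin ℝ n (H ∘ g) (g ⁻¹' O') x :=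
    ((iteratedFDerivWithin_of_isOpen n hpre) hx).symm
  have h2 : iteratedFDeriv ℝ n H (g x) = iteratedFDerivWithin ℝ n H O' (g x) :=
    ((iteratedFDerivWithin_of_isOpen n hO') hx).symm
  rw [h1, h2, g.iteratedFDerivWithin_comp_right hH hO'.uniqueDiffOn hpre.uniqueDiffOn hx le_rfl]
  refine (ContinuousMultilinearMap.norm_compContinuousLinearMap_le _ _).trans ?_
  rw [Finset.prod_const, Finset.card_univ, Fintype.card_fin, mul_comm]

/-- **Local jet bounds pull back along a continuous linear map**: if `‖DᵏH‖ ≤ B` on an open `O′`, then `‖Dᵏ(H ∘ g)‖ ≤ ‖g‖ᵏ B` on `g ⁻¹' O′`. [cite: HormanderALPDO1, §1.1 (1.1.8)] -/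
theorem bddAbove_norm_iteratedFDeriv_comp_clm_image (g : V →L[ℝ] V') {O' : Set V'} (hO' : IsOpen O') {H : V' → F} {n : ℕ} (hH : ContDiffOn ℝ n H O')
    {A : Set V} (hA : MapsTo g A O') (hb : BddAbove ((fun y => ‖iteratedFDeriv ℝ n H y‖) '' (g '' A))) :
    BddAbove ((fun x => ‖iteratedFDeriv ℝ n (H ∘ g) x‖) '' A) := by
  obtain ⟨B, hB⟩ := hb
  refine ⟨‖g‖ ^ n * max B 0, ?_⟩
  rintro _ ⟨x, hx, rfl⟩
  refine (norm_iteratedFDeriv_comp_clm_le_of_isOpen g hO' hH (hA hx)).trans ?_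
  exact mul_le_mul_of_nonneg_left ((hB ⟨g x, ⟨x, hx, rfl⟩, rfl⟩).trans (le_max_left _ _)) (pow_nonneg (norm_nonneg _) _)

variable {𝔸 : Type*} [NormedRing 𝔸] [NormedAlgebra ℝ 𝔸]

/-- **Leibniz packaging of LOCAL jet bounds**: `f` smooth everywhere, `H` of class `Cⁿ` on an open `O` with every jet of order `≤ n` bounded on `U ∩ O` for some neighbourhood `U` of `x`
⇒ the `n`-jet of `f · H` is bounded on `U′ ∩ O` for a neighbourhood `U′` of `x` (Mathlib `norm_iteratedFDerivWithin_mul_le`; the jets of `f` are bounded near `x` by continuity).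
[cite: HormanderALPDO1, §1.1 (1.1.9)] -/
theorem exists_nhds_bddAbove_norm_iteratedFDeriv_mul {f H : V → 𝔸} (hf : ContDiff ℝ ∞ f) {O : Set V} (hO : IsOpen O) {n : ℕ} (hH : ContDiffOn ℝ n H O) {x : V}
    (hb : ∀ k ≤ n, ∃ U ∈ 𝓝 x, BddAbove ((fun y => ‖iteratedFDeriv ℝ k H y‖) '' (U ∩ O))) :
    ∃ U ∈ 𝓝 x, BddAbove ((fun y => ‖iteratedFDeriv ℝ n (fun y => f y * H y) y‖) '' (U ∩ O)) := by
  -- eventual bounds for the jets of `H` of order `≤ n`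
  have hHev : ∀ k : Fin (n + 1), ∃ B : ℝ, ∀ᶠ y in 𝓝 x, y ∈ O → ‖iteratedFDeriv ℝ (k : ℕ) H y‖ ≤ B := by
    intro k
    obtain ⟨U, hU, B, hB⟩ := hb k (Nat.lt_succ_iff.1 k.2)
    exact ⟨B, Filter.mem_of_superset hU fun y hy hyO => hB ⟨y, ⟨hy, hyO⟩, rfl⟩⟩
  choose B hB using hHev
  -- eventual bounds for the jets of `f` (continuity)
  have hfev : ∀ k : Fin (n + 1), ∀ᶠ y in 𝓝 x, ‖iteratedFDeriv ℝ (k : ℕ) f y‖ ≤ ‖iteratedFDeriv ℝ (k : ℕ) f x‖ + 1 := by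
    intro k
    have hc : Continuous fun y => ‖iteratedFDeriv ℝ (k : ℕ) f y‖ := (hf.continuous_iteratedFDeriv (mod_cast le_top)).norm
    exact ((hc.tendsto x).eventually (gt_mem_nhds (lt_add_one _))).mono fun y hy => hy.le
  have hall : ∀ᶠ y in 𝓝 x, ∀ k : Fin (n + 1), (y ∈ O → ‖iteratedFDeriv ℝ (k : ℕ) H y‖ ≤ B k) ∧ ‖iteratedFDeriv ℝ (k : ℕ) f y‖ ≤ ‖iteratedFDeriv ℝ (k : ℕ) f x‖ + 1 :=
    eventually_all.2 fun k => (hB k).and (hfev k)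
  -- non-dependent bound tables
  set B' : ℕ → ℝ := fun m => if h : m < n + 1 then max (B ⟨m, h⟩) 0 else 0 with hB'
  refine ⟨{y | ∀ k : Fin (n + 1), (y ∈ O → ‖iteratedFDeriv ℝ (k : ℕ) H y‖ ≤ B k) ∧ ‖iteratedFDeriv ℝ (k : ℕ) f y‖ ≤ ‖iteratedFDeriv ℝ (k : ℕ) f x‖ + 1}, hall,
    ∑ i ∈ Finset.range (n + 1), (n.choose i : ℝ) * (‖iteratedFDeriv ℝ i f x‖ + 1) * B' (n - i), ?_⟩
  rintro _ ⟨y, ⟨hy, hyO⟩, rfl⟩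
  have hfO : ContDiffOn ℝ n f O := (hf.of_le (mod_cast le_top)).contDiffOn
  show ‖iteratedFDeriv ℝ n (fun y => f y * H y) y‖ ≤ _
  rw [← (iteratedFDerivWithin_of_isOpen n hO) hyO]
  refine (norm_iteratedFDerivWithin_mul_le hfO hH hO.uniqueDiffOn hyO le_rfl).trans (Finset.sum_le_sum fun i hi => ?_)
  have hi' : i < n + 1 := Finset.mem_range.1 hi
  have hni : n - i < n + 1 := by omega
  rw [(iteratedFDerivWithin_of_isOpen i hO) hyO, (iteratedFDerivWithin_of_isOpen (n - i) hO) hyO]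
  have h1 : ‖iteratedFDeriv ℝ i f y‖ ≤ ‖iteratedFDeriv ℝ i f x‖ + 1 := (hy ⟨i, hi'⟩).2
  have h2 : ‖iteratedFDeriv ℝ (n - i) H y‖ ≤ B' (n - i) := by
    have h := (hy ⟨n - i, hni⟩).1 hyO
    simp only [hB', dif_pos hni]
    exact h.trans (le_max_left _ _)
  calc (n.choose i : ℝ) * ‖iteratedFDeriv ℝ i f y‖ * ‖iteratedFDeriv ℝ (n - i) H y‖
      ≤ (n.choose i : ℝ) * (‖iteratedFDeriv ℝ i f x‖ + 1) * B' (n - i) := by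
        gcongr

end Literature.Analysis.Calculus

/-! ## §2 The semiregular neighbourhood: near a face point, `InRegG` is the complement of ONE wall -/

namespace Literature.NumberTheory.Rogawski1990

open Literature.NumberTheory.Automorphic Literature.NumberTheory.Automorphic.UnitaryGroup Literature.NumberTheory.Automorphic.ArchCartan

section Semireg

variable {W : Type*} [Fintype W] [DecidableEq W]

/-- **NEAR A SEMIREGULAR POINT OF THE NONCOMPACT WALL `(w, i, j)`, `InRegG s S′` IS THE COMPLEMENT OF THAT ONE WALL**: there is an open neighbourhood `U ∋ p` on which
`c ∈ InRegG s S′ ↔ e^{i c_w i} ≠ e^{i c_w j} ↔ c w i ≠ c w j`, and every such `c` is even `G`-REGULAR (★ `exists_nhds_hcSemireg` + ★ `mem_regG_of_offWall`; `s w i ≠ s w j` makes the wall a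
genuinely removed one).  So the (I₁) supremum over `K ∩ InRegG` near a face point is a supremum over a punctured product neighbourhood. [cite: Shelstad1979, §4 p. 22]
[cite: Bouaziz1994IntegralesOrbitales, §3.2 p. 580; §6.2 p. 591] -/
theorem exists_nhds_forall_mem_inRegG_iff_of_hcSemireg (s : W → Fin 3 → SignType) {S' : Finset W} {w : W} (hw : w ∉ S') {i j : Fin 3} (hij : i ≠ j)
    (hs : s w i ≠ s w j) {p : W → Fin 3 → ℝ} (hp : HcSemireg S' w i j p) :
    ∃ U : Set (W → Fin 3 → ℝ), IsOpen U ∧ p ∈ U ∧ ∀ c ∈ U,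
      (c ∈ InRegG s S' ↔ Circle.exp (c w i) ≠ Circle.exp (c w j)) ∧ (Circle.exp (c w i) ≠ Circle.exp (c w j) ↔ c w i ≠ c w j) ∧ (c w i ≠ c w j → c ∈ RegG S') := by
  obtain ⟨U, hUo, hpU, -, h1, h2, h3, h4⟩ := exists_nhds_hcSemireg hw hij hp
  refine ⟨U, hUo, hpU, fun c hc => ?_⟩
  have hreg : c w i ≠ c w j → c ∈ RegG S' := fun hne => mem_regG_of_offWall hij (h1 c hc) (h2 c hc) (h3 c hc) (h4 c hc) hne
  have hiff : Circle.exp (c w i) ≠ Circle.exp (c w j) ↔ c w i ≠ c w j :=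
    ⟨fun h heq => h (by rw [heq]), fun hne => circleExp_ne_of_abs_sub_lt_two_pi hne (by linarith [h1 c hc, Real.pi_pos])⟩
  refine ⟨⟨fun hc' => hc' w hw i j hij hs, fun hne => regG_subset_inRegG s S' (hreg (hiff.1 hne))⟩, hiff, hreg⟩

omit [Fintype W] in
/-- `e^{ρ}_{S′}(c) ≠ 0` (a finite product of unit complex numbers). [cite: Shelstad1979, §4 p. 24] -/
theorem archERhoG_ne_zero_of_fintype [Fintype W] (S' : Finset W) (c : W → Fin 3 → ℝ) : archERhoG S' c ≠ 0 := by
  unfold archERhoG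
  exact Finset.prod_ne_zero_iff.2 fun w _ => by
    split_ifs
    · exact one_ne_zero
    · exact Circle.coe_ne_zero _

end Semireg

/-! ## §3 THE HEAD (binder form): local jet bounds of `orbFamGExt` at a face point from a `Cⁿ` model of the twisted family off the wall -/

section Head

variable (L : Type) [Field L] [NumberField L] [IsCMField L] (α : Fin 3 → L)
  [MeasurableSpace ↥(arch (↥(maximalRealSubfield L)) L (IsCMField.complexConj L) 3 (Matrix.diagonal α))]
  [BorelSpace ↥(arch (↥(maximalRealSubfield L)) L (IsCMField.complexConj L) 3 (Matrix.diagonal α))]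
  (ν' : Measure ↥(arch (↥(maximalRealSubfield L)) L (IsCMField.complexConj L) 3 (Matrix.diagonal α))) [IsFiniteMeasureOnCompacts ν'] [ν'.IsMulRightInvariant]
  (a' : ↥(arch (↥(maximalRealSubfield L)) L (IsCMField.complexConj L) 3 (Matrix.diagonal α)) → ℂ)
  (S' : Finset {w : InfinitePlace L // IsComplex w})

/-- **(I₁) AT A FACE, BINDER FORM — LOCAL JET BOUNDS OF `orbFamGExt` AT A SEMIREGULAR WALL POINT FROM A MODEL OF THE TWISTED FAMILY.**  At a semiregular point `p` of the
noncompact wall `(w, i, j)` (`w ∉ S′`, `slotSign w i ≠ slotSign w j`): if on a neighbourhood `U` of `p`, OFF the wall, the twisted family `e^{ρ}_{S′} · orbFamGExt ν′ a′ S′` equals a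
model `H` ((B-desc)'s parametric descent identity — Harish-Chandra descent to `U(1,1)_w`, read on a product neighbourhood), and `H` is `Cⁿ` off the wall with every jet of order `≤ n`
bounded near `p` off the wall (★ (ELL-∞-UNIF) + (B2a)∕(B2b) — the rank-one model bound, uniform in the transversal parameters), THEN the `n`-jet of `orbFamGExt ν′ a′ S′` is bounded
on `U′ ∩ InRegG (slotSign α) S′` for a neighbourhood `U′` of `p` — the `hwall` binder of ★ `bddAbove_norm_iteratedFDeriv_inter_inRegG_of_forall_wall` (LH7-p04) at the face point.
Proof: near `p`, `InRegG` is the complement of the one wall (§2); there `orbFamGExt = (e^{ρ})⁻¹ · H` with the smooth unit `(archERhoG S′)⁻¹`; Leibniz (§1).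
[cite: Varadarajan1977, Part I §1.12] [cite: Bouaziz1994IntegralesOrbitales, §3.1 (I₁) p. 579; §3.2 p. 580] [cite: Shelstad1979, §4 pp. 22–24] -/
theorem exists_nhds_bddAbove_norm_iteratedFDeriv_orbFamGExt_of_faceModel {w : {w : InfinitePlace L // IsComplex w}} (hw : w ∉ S') {i j : Fin 3} (hij : i ≠ j)
    (hs : slotSign L α w i ≠ slotSign L α w j) {p : {w : InfinitePlace L // IsComplex w} → Fin 3 → ℝ} (hp : HcSemireg S' w i j p)
    {U : Set ({w : InfinitePlace L // IsComplex w} → Fin 3 → ℝ)} (hU : U ∈ 𝓝 p) (H : ({w : InfinitePlace L // IsComplex w} → Fin 3 → ℝ) → ℂ)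
    (hfac : ∀ c ∈ U, Circle.exp (c w i) ≠ Circle.exp (c w j) → archERhoG S' c * orbFamGExt L α ν' a' S' c = H c)
    (n : ℕ) (hHs : ContDiffOn ℝ n H (U ∩ {c | Circle.exp (c w i) ≠ Circle.exp (c w j)}))
    (hHb : ∀ k ≤ n, ∃ U' ∈ 𝓝 p, BddAbove ((fun c => ‖iteratedFDeriv ℝ k H c‖) '' (U' ∩ {c | Circle.exp (c w i) ≠ Circle.exp (c w j)}))) :
    ∃ U' ∈ 𝓝 p, BddAbove ((fun c => ‖iteratedFDeriv ℝ n (orbFamGExt L α ν' a' S') c‖) '' (U' ∩ InRegG (slotSign L α) S')) := by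
  obtain ⟨U₀, hU₀o, hpU₀, hU₀⟩ := exists_nhds_forall_mem_inRegG_iff_of_hcSemireg (slotSign L α) hw hij hs hp
  -- the open set where the model is read
  set O : Set ({w : InfinitePlace L // IsComplex w} → Fin 3 → ℝ) := interior U ∩ U₀ ∩ {c | Circle.exp (c w i) ≠ Circle.exp (c w j)} with hO
  have hOo : IsOpen O := (isOpen_interior.inter hU₀o).inter (isOpen_ne_fun (continuous_circleExp_coord w i) (continuous_circleExp_coord w j))
  have hOsub : O ⊆ U ∩ {c | Circle.exp (c w i) ≠ Circle.exp (c w j)} := fun c hc => ⟨interior_subset hc.1.1, hc.2⟩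
  -- the smooth unit `(e^ρ)⁻¹`
  have hf : ContDiff ℝ ∞ fun c : {w : InfinitePlace L // IsComplex w} → Fin 3 → ℝ => (archERhoG S' c)⁻¹ := (contDiff_archERhoG S').inv fun c => archERhoG_ne_zero_of_fintype S' c
  have hb : ∀ k ≤ n, ∃ U' ∈ 𝓝 p, BddAbove ((fun c => ‖iteratedFDeriv ℝ k H c‖) '' (U' ∩ O)) := by
    intro k hk
    obtain ⟨U', hU', hB⟩ := hHb k hk
    exact ⟨U', hU', hB.mono (image_mono fun c hc => show c ∈ U' ∩ {c | Circle.exp (c w i) ≠ Circle.exp (c w j)} from ⟨hc.1, hc.2.2⟩)⟩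
  obtain ⟨U₁, hU₁, hB⟩ := Literature.Analysis.Calculus.exists_nhds_bddAbove_norm_iteratedFDeriv_mul hf hOo (hHs.mono hOsub) hb
  -- on `O` the family IS `(e^ρ)⁻¹ · H`
  have hEq : ∀ c ∈ O, orbFamGExt L α ν' a' S' c = (archERhoG S' c)⁻¹ * H c := by
    intro c hc
    rw [← hfac c (hOsub hc).1 (hOsub hc).2, ← mul_assoc, inv_mul_cancel₀ (archERhoG_ne_zero_of_fintype S' c), one_mul]
  have hpO' : interior U ∩ U₀ ∈ 𝓝 p := inter_mem (isOpen_interior.mem_nhds (mem_interior_iff_mem_nhds.2 hU)) (hU₀o.mem_nhds hpU₀)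
  refine ⟨U₁ ∩ (interior U ∩ U₀), inter_mem hU₁ hpO', hB.mono ?_⟩
  rintro _ ⟨c, ⟨⟨hc₁, hcU, hcU₀⟩, hcreg⟩, rfl⟩
  have hcwall : Circle.exp (c w i) ≠ Circle.exp (c w j) := ((hU₀ c hcU₀).1).1 hcreg
  have hcO : c ∈ O := ⟨⟨hcU, hcU₀⟩, hcwall⟩
  refine ⟨c, ⟨hc₁, hcO⟩, ?_⟩
  have hev : (fun c => (archERhoG S' c)⁻¹ * H c) =ᶠ[𝓝 c] orbFamGExt L α ν' a' S' :=
    Filter.eventuallyEq_of_mem (hOo.mem_nhds hcO) fun y hy => (hEq y hy).symm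
  show ‖iteratedFDeriv ℝ n (fun y => (archERhoG S' y)⁻¹ * H y) c‖ = ‖iteratedFDeriv ℝ n (orbFamGExt L α ν' a' S') c‖
  rw [(hev.iteratedFDeriv ℝ n).eq_of_nhds]

/-- **The `∀ n` form**: with jets of ALL orders of the model bounded near `p` off the wall, every jet of `orbFamGExt ν′ a′ S′` is bounded near `p` on `InRegG`.
[cite: Bouaziz1994IntegralesOrbitales, §3.1 (I₁) p. 579] [cite: Varadarajan1977, Part I §1.12] -/
theorem forall_exists_nhds_bddAbove_norm_iteratedFDeriv_orbFamGExt_of_faceModel {w : {w : InfinitePlace L // IsComplex w}} (hw : w ∉ S') {i j : Fin 3} (hij : i ≠ j)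
    (hs : slotSign L α w i ≠ slotSign L α w j) {p : {w : InfinitePlace L // IsComplex w} → Fin 3 → ℝ} (hp : HcSemireg S' w i j p)
    {U : Set ({w : InfinitePlace L // IsComplex w} → Fin 3 → ℝ)} (hU : U ∈ 𝓝 p) (H : ({w : InfinitePlace L // IsComplex w} → Fin 3 → ℝ) → ℂ)
    (hfac : ∀ c ∈ U, Circle.exp (c w i) ≠ Circle.exp (c w j) → archERhoG S' c * orbFamGExt L α ν' a' S' c = H c)
    (hHs : ContDiffOn ℝ ∞ H (U ∩ {c | Circle.exp (c w i) ≠ Circle.exp (c w j)}))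
    (hHb : ∀ k : ℕ, ∃ U' ∈ 𝓝 p, BddAbove ((fun c => ‖iteratedFDeriv ℝ k H c‖) '' (U' ∩ {c | Circle.exp (c w i) ≠ Circle.exp (c w j)}))) (n : ℕ) :
    ∃ U' ∈ 𝓝 p, BddAbove ((fun c => ‖iteratedFDeriv ℝ n (orbFamGExt L α ν' a' S') c‖) '' (U' ∩ InRegG (slotSign L α) S')) :=
  exists_nhds_bddAbove_norm_iteratedFDeriv_orbFamGExt_of_faceModel L α ν' a' S' hw hij hs hp hU H hfac n (hHs.of_le (mod_cast le_top)) fun k _ => hHb k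

/-! ## §4 The product-coordinate reading: the model is a pull-back `H₂ ∘ A` along a continuous linear chart -/

/-- **(I₁) AT A FACE, PRODUCT-COORDINATE FORM.**  Same as `exists_nhds_bddAbove_norm_iteratedFDeriv_orbFamGExt_of_faceModel`, with the model read in PRODUCT COORDINATES: the twisted
family equals `H₂ (A c)` off the wall near `p` for a continuous linear chart `A : V →L P` (e.g. `A c = (π c, ν c) ∈ V × ℝ`, wall projection × normal coordinate, SPEC-I3 §1) and a model
`H₂` of class `Cⁿ` with bounded jets of order `≤ n` on an OPEN set `O₂ ⊆ P` containing the images of the off-wall points of `U` (e.g. `O₂ = Q ×ˢ {0 < |ψ| < δ}`, the punctured product box —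
where ★ (ELL-∞-UNIF) + (B2a)∕(B2b) bound the mixed partials `∂_ψ^a ∂_q^β`).  The pull-back costs the factor `‖A‖ᵏ` (§1).
[cite: Varadarajan1977, Part I §1.12] [cite: Bouaziz1994IntegralesOrbitales, §3.1 (I₁)–(I₂) p. 579] [cite: HormanderALPDO1, §1.1 (1.1.8)] -/
theorem exists_nhds_bddAbove_norm_iteratedFDeriv_orbFamGExt_of_productModel {w : {w : InfinitePlace L // IsComplex w}} (hw : w ∉ S') {i j : Fin 3} (hij : i ≠ j)
    (hs : slotSign L α w i ≠ slotSign L α w j) {p : {w : InfinitePlace L // IsComplex w} → Fin 3 → ℝ} (hp : HcSemireg S' w i j p)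
    {P : Type*} [NormedAddCommGroup P] [NormedSpace ℝ P] (A : ({w : InfinitePlace L // IsComplex w} → Fin 3 → ℝ) →L[ℝ] P) (H₂ : P → ℂ)
    {U : Set ({w : InfinitePlace L // IsComplex w} → Fin 3 → ℝ)} (hU : U ∈ 𝓝 p)
    (hfac : ∀ c ∈ U, Circle.exp (c w i) ≠ Circle.exp (c w j) → archERhoG S' c * orbFamGExt L α ν' a' S' c = H₂ (A c))
    {O₂ : Set P} (hO₂ : IsOpen O₂) (hAO : ∀ c ∈ U, Circle.exp (c w i) ≠ Circle.exp (c w j) → A c ∈ O₂)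
    (n : ℕ) (hH₂s : ContDiffOn ℝ n H₂ O₂) (hH₂b : ∀ k ≤ n, BddAbove ((fun y => ‖iteratedFDeriv ℝ k H₂ y‖) '' O₂)) :
    ∃ U' ∈ 𝓝 p, BddAbove ((fun c => ‖iteratedFDeriv ℝ n (orbFamGExt L α ν' a' S') c‖) '' (U' ∩ InRegG (slotSign L α) S')) := by
  have hmaps : MapsTo A (U ∩ {c | Circle.exp (c w i) ≠ Circle.exp (c w j)}) O₂ := fun c hc => hAO c hc.1 hc.2
  refine exists_nhds_bddAbove_norm_iteratedFDeriv_orbFamGExt_of_faceModel L α ν' a' S' hw hij hs hp hU (H₂ ∘ A) (fun c hc hcw => hfac c hc hcw) n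
    (hH₂s.comp A.contDiff.contDiffOn hmaps) fun k hk => ⟨U, hU, ?_⟩
  exact Literature.Analysis.Calculus.bddAbove_norm_iteratedFDeriv_comp_clm_image A hO₂ (hH₂s.of_le (mod_cast hk)) hmaps
    ((hH₂b k hk).mono (image_mono (mapsTo_iff_image_subset.1 hmaps)))

end Head


/-! ## ED. 2 (append-only) — the ONE-WALL point hypothesis: faces of the (F) stratum that are NOT `HcSemireg` (a compact coincidence or a real wall ∕ scalar split point elsewhere)

LH7-p04 (g4) 2026-09-02T10:30:17Z ∕ 10:33:39Z ((F′) flag, brick (B-desc′) `exists_descent_box_orbFamGExt_inRegG`): §3–§4 only USE, of `HcSemireg`, the one-wall description of `InRegG`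
near the base point; it holds at every point with exactly one noncompact coincidence `(w, i, j)` and all OTHER noncompact pairs at compact places distinct (compact walls, real walls and
scalar split points elsewhere are allowed — they lie inside `InRegG`).  The heads `…_oneWall` below take that triple `(hx, hxk, hxin)` instead of `HcSemireg` (at `(i, j) = (0, 2)` it is
(B-desc′)'s base-point text `(hx02, hx1, hxin)` verbatim, `hcThird 0 2 = 1`). -/

section OneWall

variable {W : Type*} [Fintype W] [DecidableEq W]

/-- **NEAR A ONE-WALL POINT `InRegG s S′` IS THE COMPLEMENT OF THAT WALL**: at `x` with `x w i = x w j` (the noncompact wall `(w, i, j)`, `s w i ≠ s w j`, `w ∉ S′`), the third eigenvalue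
at `w` off both (`hxk`) and every OTHER noncompact pair at the compact places distinct (`hxin`), there is an open `U ∋ x` with
`c ∈ InRegG s S′ ↔ e^{i c_w i} ≠ e^{i c_w j} ↔ c w i ≠ c w j` on `U` (no regularity asked at the other places: compact coincidences and split coordinates are free).
[cite: Bouaziz1994IntegralesOrbitales, §3.2 p. 580; §6.2 p. 591] [cite: Shelstad1979, §4 p. 22] -/
theorem exists_nhds_forall_mem_inRegG_iff_of_oneWall (s : W → Fin 3 → SignType) {S' : Finset W} {w : W} (hw : w ∉ S') {i j : Fin 3} (hij : i ≠ j)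
    (hs : s w i ≠ s w j) {x : W → Fin 3 → ℝ} (hx : x w i = x w j) (hxk : Circle.exp (x w (hcThird i j)) ≠ Circle.exp (x w i))
    (hxin : ∀ w', w' ∉ S' → w' ≠ w → ∀ i' j' : Fin 3, i' ≠ j' → s w' i' ≠ s w' j' → Circle.exp (x w' i') ≠ Circle.exp (x w' j')) :
    ∃ U : Set (W → Fin 3 → ℝ), IsOpen U ∧ x ∈ U ∧ ∀ c ∈ U,
      (c ∈ InRegG s S' ↔ Circle.exp (c w i) ≠ Circle.exp (c w j)) ∧ (Circle.exp (c w i) ≠ Circle.exp (c w j) ↔ c w i ≠ c w j) := by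
  -- the four open conditions
  set U₁ : Set (W → Fin 3 → ℝ) := {c | |c w i - c w j| < Real.pi} with hU₁
  set U₂ : Set (W → Fin 3 → ℝ) := {c | Circle.exp (c w (hcThird i j)) ≠ Circle.exp (c w i)} with hU₂
  set U₃ : Set (W → Fin 3 → ℝ) := {c | Circle.exp (c w (hcThird i j)) ≠ Circle.exp (c w j)} with hU₃
  set U₄ : Set (W → Fin 3 → ℝ) := ⋂ w' : W, ⋂ i' : Fin 3, ⋂ j' : Fin 3,
    {c | w' ∉ S' → w' ≠ w → i' ≠ j' → s w' i' ≠ s w' j' → Circle.exp (c w' i') ≠ Circle.exp (c w' j')} with hU₄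
  have hdiff : Continuous fun c : W → Fin 3 → ℝ => c w i - c w j := by fun_prop
  have hO₁ : IsOpen U₁ := isOpen_lt (continuous_abs.comp hdiff) continuous_const
  have hO₂ : IsOpen U₂ := isOpen_ne_fun (continuous_circleExp_coord w _) (continuous_circleExp_coord w i)
  have hO₃ : IsOpen U₃ := isOpen_ne_fun (continuous_circleExp_coord w _) (continuous_circleExp_coord w j)
  have hO₄ : IsOpen U₄ := by
    refine isOpen_iInter_of_finite fun w' => isOpen_iInter_of_finite fun i' => isOpen_iInter_of_finite fun j' => ?_
    by_cases hP : w' ∉ S' ∧ w' ≠ w ∧ i' ≠ j' ∧ s w' i' ≠ s w' j'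
    · have : {c : W → Fin 3 → ℝ | w' ∉ S' → w' ≠ w → i' ≠ j' → s w' i' ≠ s w' j' → Circle.exp (c w' i') ≠ Circle.exp (c w' j')} =
          {c | Circle.exp (c w' i') ≠ Circle.exp (c w' j')} := by
        ext c; simp only [mem_setOf_eq]; exact ⟨fun h => h hP.1 hP.2.1 hP.2.2.1 hP.2.2.2, fun h _ _ _ _ => h⟩
      rw [this]
      exact isOpen_ne_fun (continuous_circleExp_coord w' i') (continuous_circleExp_coord w' j')
    · have : {c : W → Fin 3 → ℝ | w' ∉ S' → w' ≠ w → i' ≠ j' → s w' i' ≠ s w' j' → Circle.exp (c w' i') ≠ Circle.exp (c w' j')} = univ := by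
        ext c; simp only [mem_setOf_eq, mem_univ, iff_true]; exact fun h1 h2 h3 h4 => (hP ⟨h1, h2, h3, h4⟩).elim
      rw [this]
      exact isOpen_univ
  refine ⟨U₁ ∩ U₂ ∩ U₃ ∩ U₄, ((hO₁.inter hO₂).inter hO₃).inter hO₄, ⟨⟨⟨?_, hxk⟩, ?_⟩, ?_⟩, fun c hc => ?_⟩
  · show |x w i - x w j| < Real.pi
    rw [hx, sub_self, abs_zero]; exact Real.pi_pos
  · show Circle.exp (x w (hcThird i j)) ≠ Circle.exp (x w j)
    rw [← hx]; exact hxk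
  · simp only [hU₄, mem_iInter, mem_setOf_eq]
    exact fun w' i' j' h1 h2 h3 h4 => hxin w' h1 h2 i' j' h3 h4
  obtain ⟨⟨⟨hc₁, hc₂⟩, hc₃⟩, hc₄⟩ := hc
  have hc₄' : ∀ w', w' ∉ S' → w' ≠ w → ∀ i' j' : Fin 3, i' ≠ j' → s w' i' ≠ s w' j' → Circle.exp (c w' i') ≠ Circle.exp (c w' j') := by
    simp only [hU₄, mem_iInter, mem_setOf_eq] at hc₄
    exact fun w' h1 h2 i' j' h3 h4 => hc₄ w' i' j' h1 h2 h3 h4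
  have hiff : Circle.exp (c w i) ≠ Circle.exp (c w j) ↔ c w i ≠ c w j :=
    ⟨fun h heq => h (by rw [heq]), fun hne => circleExp_ne_of_abs_sub_lt_two_pi hne (by have h1 : |c w i - c w j| < Real.pi := hc₁; linarith [Real.pi_pos])⟩
  refine ⟨⟨fun hc' => hc' w hw i j hij hs, fun hne => ?_⟩, hiff⟩
  intro w' hw' i' j' hij' hs'
  by_cases hww : w' = w
  · subst hww
    have hinj : Function.Injective fun l : Fin 3 => Circle.exp (c w' l) :=
      injective_of_pair_of_third hij hne fun l hl1 hl2 => by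
        rw [eq_hcThird_of_ne_of_ne hij hl1 hl2]; exact ⟨hc₂, hc₃⟩
    exact hinj.ne hij'
  · exact hc₄' w' hw' hww i' j' hij' hs'

end OneWall

section HeadOneWall

variable (L : Type) [Field L] [NumberField L] [IsCMField L] (α : Fin 3 → L)
  [MeasurableSpace ↥(arch (↥(maximalRealSubfield L)) L (IsCMField.complexConj L) 3 (Matrix.diagonal α))]
  [BorelSpace ↥(arch (↥(maximalRealSubfield L)) L (IsCMField.complexConj L) 3 (Matrix.diagonal α))]
  (ν' : Measure ↥(arch (↥(maximalRealSubfield L)) L (IsCMField.complexConj L) 3 (Matrix.diagonal α))) [IsFiniteMeasureOnCompacts ν'] [ν'.IsMulRightInvariant]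
  (a' : ↥(arch (↥(maximalRealSubfield L)) L (IsCMField.complexConj L) 3 (Matrix.diagonal α)) → ℂ)
  (S' : Finset {w : InfinitePlace L // IsComplex w})

/-- **(I₁) AT A ONE-WALL POINT, BINDER FORM** — ★ `exists_nhds_bddAbove_norm_iteratedFDeriv_orbFamGExt_of_faceModel` with the base point `x` of the (F) stratum (`hx, hxk, hxin` instead of
`HcSemireg`): a `Cⁿ` model of the twisted family off the wall near `x` with bounded jets of order `≤ n` ⇒ the `n`-jet of `orbFamGExt ν′ a′ S′` is bounded on `U′ ∩ InRegG` for a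
neighbourhood `U′` of `x`. [cite: Varadarajan1977, Part I §1.12] [cite: Bouaziz1994IntegralesOrbitales, §3.1 (I₁) p. 579; §3.2 p. 580] [cite: Shelstad1979, §4 pp. 22–24] -/
theorem exists_nhds_bddAbove_norm_iteratedFDeriv_orbFamGExt_of_faceModel_oneWall {w : {w : InfinitePlace L // IsComplex w}} (hw : w ∉ S') {i j : Fin 3} (hij : i ≠ j)
    (hs : slotSign L α w i ≠ slotSign L α w j) {x : {w : InfinitePlace L // IsComplex w} → Fin 3 → ℝ} (hx : x w i = x w j)
    (hxk : Circle.exp (x w (hcThird i j)) ≠ Circle.exp (x w i))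
    (hxin : ∀ w', w' ∉ S' → w' ≠ w → ∀ i' j' : Fin 3, i' ≠ j' → slotSign L α w' i' ≠ slotSign L α w' j' → Circle.exp (x w' i') ≠ Circle.exp (x w' j'))
    {U : Set ({w : InfinitePlace L // IsComplex w} → Fin 3 → ℝ)} (hU : U ∈ 𝓝 x) (H : ({w : InfinitePlace L // IsComplex w} → Fin 3 → ℝ) → ℂ)
    (hfac : ∀ c ∈ U, Circle.exp (c w i) ≠ Circle.exp (c w j) → archERhoG S' c * orbFamGExt L α ν' a' S' c = H c)
    (n : ℕ) (hHs : ContDiffOn ℝ n H (U ∩ {c | Circle.exp (c w i) ≠ Circle.exp (c w j)}))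
    (hHb : ∀ k ≤ n, ∃ U' ∈ 𝓝 x, BddAbove ((fun c => ‖iteratedFDeriv ℝ k H c‖) '' (U' ∩ {c | Circle.exp (c w i) ≠ Circle.exp (c w j)}))) :
    ∃ U' ∈ 𝓝 x, BddAbove ((fun c => ‖iteratedFDeriv ℝ n (orbFamGExt L α ν' a' S') c‖) '' (U' ∩ InRegG (slotSign L α) S')) := by
  obtain ⟨U₀, hU₀o, hpU₀, hU₀⟩ := exists_nhds_forall_mem_inRegG_iff_of_oneWall (slotSign L α) hw hij hs hx hxk hxin
  set O : Set ({w : InfinitePlace L // IsComplex w} → Fin 3 → ℝ) := interior U ∩ U₀ ∩ {c | Circle.exp (c w i) ≠ Circle.exp (c w j)} with hO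
  have hOo : IsOpen O := (isOpen_interior.inter hU₀o).inter (isOpen_ne_fun (continuous_circleExp_coord w i) (continuous_circleExp_coord w j))
  have hOsub : O ⊆ U ∩ {c | Circle.exp (c w i) ≠ Circle.exp (c w j)} := fun c hc => ⟨interior_subset hc.1.1, hc.2⟩
  have hf : ContDiff ℝ ∞ fun c : {w : InfinitePlace L // IsComplex w} → Fin 3 → ℝ => (archERhoG S' c)⁻¹ := (contDiff_archERhoG S').inv fun c => archERhoG_ne_zero_of_fintype S' c
  have hb : ∀ k ≤ n, ∃ U' ∈ 𝓝 x, BddAbove ((fun c => ‖iteratedFDeriv ℝ k H c‖) '' (U' ∩ O)) := by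
    intro k hk
    obtain ⟨U', hU', hB⟩ := hHb k hk
    exact ⟨U', hU', hB.mono (image_mono fun c hc => show c ∈ U' ∩ {c | Circle.exp (c w i) ≠ Circle.exp (c w j)} from ⟨hc.1, hc.2.2⟩)⟩
  obtain ⟨U₁, hU₁, hB⟩ := Literature.Analysis.Calculus.exists_nhds_bddAbove_norm_iteratedFDeriv_mul hf hOo (hHs.mono hOsub) hb
  have hEq : ∀ c ∈ O, orbFamGExt L α ν' a' S' c = (archERhoG S' c)⁻¹ * H c := by
    intro c hc
    rw [← hfac c (hOsub hc).1 (hOsub hc).2, ← mul_assoc, inv_mul_cancel₀ (archERhoG_ne_zero_of_fintype S' c), one_mul]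
  have hpO' : interior U ∩ U₀ ∈ 𝓝 x := inter_mem (isOpen_interior.mem_nhds (mem_interior_iff_mem_nhds.2 hU)) (hU₀o.mem_nhds hpU₀)
  refine ⟨U₁ ∩ (interior U ∩ U₀), inter_mem hU₁ hpO', hB.mono ?_⟩
  rintro _ ⟨c, ⟨⟨hc₁, hcU, hcU₀⟩, hcreg⟩, rfl⟩
  have hcwall : Circle.exp (c w i) ≠ Circle.exp (c w j) := ((hU₀ c hcU₀).1).1 hcreg
  have hcO : c ∈ O := ⟨⟨hcU, hcU₀⟩, hcwall⟩
  refine ⟨c, ⟨hc₁, hcO⟩, ?_⟩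
  have hev : (fun c => (archERhoG S' c)⁻¹ * H c) =ᶠ[𝓝 c] orbFamGExt L α ν' a' S' :=
    Filter.eventuallyEq_of_mem (hOo.mem_nhds hcO) fun y hy => (hEq y hy).symm
  show ‖iteratedFDeriv ℝ n (fun y => (archERhoG S' y)⁻¹ * H y) c‖ = ‖iteratedFDeriv ℝ n (orbFamGExt L α ν' a' S') c‖
  rw [(hev.iteratedFDeriv ℝ n).eq_of_nhds]

/-- **The `∀ n` form at a one-wall point.** [cite: Bouaziz1994IntegralesOrbitales, §3.1 (I₁) p. 579] [cite: Varadarajan1977, Part I §1.12] -/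
theorem forall_exists_nhds_bddAbove_norm_iteratedFDeriv_orbFamGExt_of_faceModel_oneWall {w : {w : InfinitePlace L // IsComplex w}} (hw : w ∉ S') {i j : Fin 3} (hij : i ≠ j)
    (hs : slotSign L α w i ≠ slotSign L α w j) {x : {w : InfinitePlace L // IsComplex w} → Fin 3 → ℝ} (hx : x w i = x w j)
    (hxk : Circle.exp (x w (hcThird i j)) ≠ Circle.exp (x w i))
    (hxin : ∀ w', w' ∉ S' → w' ≠ w → ∀ i' j' : Fin 3, i' ≠ j' → slotSign L α w' i' ≠ slotSign L α w' j' → Circle.exp (x w' i') ≠ Circle.exp (x w' j'))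
    {U : Set ({w : InfinitePlace L // IsComplex w} → Fin 3 → ℝ)} (hU : U ∈ 𝓝 x) (H : ({w : InfinitePlace L // IsComplex w} → Fin 3 → ℝ) → ℂ)
    (hfac : ∀ c ∈ U, Circle.exp (c w i) ≠ Circle.exp (c w j) → archERhoG S' c * orbFamGExt L α ν' a' S' c = H c)
    (hHs : ContDiffOn ℝ ∞ H (U ∩ {c | Circle.exp (c w i) ≠ Circle.exp (c w j)}))
    (hHb : ∀ k : ℕ, ∃ U' ∈ 𝓝 x, BddAbove ((fun c => ‖iteratedFDeriv ℝ k H c‖) '' (U' ∩ {c | Circle.exp (c w i) ≠ Circle.exp (c w j)}))) (n : ℕ) :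
    ∃ U' ∈ 𝓝 x, BddAbove ((fun c => ‖iteratedFDeriv ℝ n (orbFamGExt L α ν' a' S') c‖) '' (U' ∩ InRegG (slotSign L α) S')) :=
  exists_nhds_bddAbove_norm_iteratedFDeriv_orbFamGExt_of_faceModel_oneWall L α ν' a' S' hw hij hs hx hxk hxin hU H hfac n (hHs.of_le (mod_cast le_top)) fun k _ => hHb k

/-- **(I₁) AT A ONE-WALL POINT, PRODUCT-COORDINATE FORM** (★ `…_of_productModel` with the (F)-stratum base point). [cite: Varadarajan1977, Part I §1.12]
[cite: Bouaziz1994IntegralesOrbitales, §3.1 (I₁)–(I₂) p. 579] [cite: HormanderALPDO1, §1.1 (1.1.8)] -/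
theorem exists_nhds_bddAbove_norm_iteratedFDeriv_orbFamGExt_of_productModel_oneWall {w : {w : InfinitePlace L // IsComplex w}} (hw : w ∉ S') {i j : Fin 3} (hij : i ≠ j)
    (hs : slotSign L α w i ≠ slotSign L α w j) {x : {w : InfinitePlace L // IsComplex w} → Fin 3 → ℝ} (hx : x w i = x w j)
    (hxk : Circle.exp (x w (hcThird i j)) ≠ Circle.exp (x w i))
    (hxin : ∀ w', w' ∉ S' → w' ≠ w → ∀ i' j' : Fin 3, i' ≠ j' → slotSign L α w' i' ≠ slotSign L α w' j' → Circle.exp (x w' i') ≠ Circle.exp (x w' j'))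
    {P : Type*} [NormedAddCommGroup P] [NormedSpace ℝ P] (A : ({w : InfinitePlace L // IsComplex w} → Fin 3 → ℝ) →L[ℝ] P) (H₂ : P → ℂ)
    {U : Set ({w : InfinitePlace L // IsComplex w} → Fin 3 → ℝ)} (hU : U ∈ 𝓝 x)
    (hfac : ∀ c ∈ U, Circle.exp (c w i) ≠ Circle.exp (c w j) → archERhoG S' c * orbFamGExt L α ν' a' S' c = H₂ (A c))
    {O₂ : Set P} (hO₂ : IsOpen O₂) (hAO : ∀ c ∈ U, Circle.exp (c w i) ≠ Circle.exp (c w j) → A c ∈ O₂)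
    (n : ℕ) (hH₂s : ContDiffOn ℝ n H₂ O₂) (hH₂b : ∀ k ≤ n, BddAbove ((fun y => ‖iteratedFDeriv ℝ k H₂ y‖) '' O₂)) :
    ∃ U' ∈ 𝓝 x, BddAbove ((fun c => ‖iteratedFDeriv ℝ n (orbFamGExt L α ν' a' S') c‖) '' (U' ∩ InRegG (slotSign L α) S')) := by
  have hmaps : MapsTo A (U ∩ {c | Circle.exp (c w i) ≠ Circle.exp (c w j)}) O₂ := fun c hc => hAO c hc.1 hc.2
  refine exists_nhds_bddAbove_norm_iteratedFDeriv_orbFamGExt_of_faceModel_oneWall L α ν' a' S' hw hij hs hx hxk hxin hU (H₂ ∘ A) (fun c hc hcw => hfac c hc hcw) n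
    (hH₂s.comp A.contDiff.contDiffOn hmaps) fun k hk => ⟨U, hU, ?_⟩
  exact Literature.Analysis.Calculus.bddAbove_norm_iteratedFDeriv_comp_clm_image A hO₂ (hH₂s.of_le (mod_cast hk)) hmaps
    ((hH₂b k hk).mono (image_mono (mapsTo_iff_image_subset.1 hmaps)))

/-- A `HcSemireg` point is a one-wall point (the (F₀) stratum ⊆ (F)). [cite: Shelstad1979, §4 p. 22] -/
theorem HcSemireg.oneWall {W : Type*} {S' : Finset W} {w : W} {i j : Fin 3} {x : W → Fin 3 → ℝ} (hp : HcSemireg S' w i j x) (s : W → Fin 3 → SignType) :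
    x w i = x w j ∧ Circle.exp (x w (hcThird i j)) ≠ Circle.exp (x w i) ∧
      ∀ w', w' ∉ S' → w' ≠ w → ∀ i' j' : Fin 3, i' ≠ j' → s w' i' ≠ s w' j' → Circle.exp (x w' i') ≠ Circle.exp (x w' j') :=
  ⟨hp.1, hp.2.1, fun w' hw' hww _ _ hij' _ => (hp.2.2.1 w' hw' hww).ne hij'⟩

end HeadOneWall

end Literature.NumberTheory.Rogawski1990

end
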